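/-
Copyright (c) 2026 the pub-hodgecm-mathlib formalisation cell (harness21).  Prover seat hodgecm-mathlib-K2Liu-p10 (g4), Track B «K2-LIT»,
#184♮ = hLiu418 = `stmt-HodgeConjecture-24832`; organ S2 «ARCH SPAN BY K-TYPE PATHS», file S2-K K-2b (LEAD F0P6-plan (g14) RULING M-158f, BATCH #7 (c) «S2-K's structure
lemma … for ARBITRARY subspaces `S ⊆ 𝒜`», BATCH #10 (3); DESIGN-S2 §3 (i), (vi)–(viii)).  KERNEL: theorems only.
-/
import Summits.HodgeConjecture.HodgeConjecture.Theorems.K2LiuU22KTypeEigenvalues   -- ★ K-2a p860219 (Euler ∕ Casimir eigenvalues, injectivity; brings K-1b, K-1, DEFS)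
import Mathlib.Algebra.BigOperators.Ring.Finset
import HarnessLib

/-!
# Crux `HLiu418`, organ S2, file S2-K K-2b: THE STRUCTURE LEMMA FOR `𝔨_ℂ`-STABLE SUBSPACES OF `ℂ[u, D⁻¹]`
# (A) COMPONENT EXTRACTION by the Euler and Casimir operators; (B) CYCLICITY: `W_{(k+l,l)} ⊆ S` as soon as its highest-weight vector `u₀₀^k D^l ∈ S`

Cell `hodgecm-mathlib`, crux item hLiu418 = `stmt-HodgeConjecture-24832`, route of record `HCCMUnconditional`; squad K2 ∕ K2Liu, prover K2Liu-p10 (g4).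
THEOREMS ONLY (no `def`, no `instance`, no notation, no named-fact hypothesis, no `sorry`); lane `--supports stmt-HodgeConjecture-24832 --as helper`.

What S2-C ∕ S2-asm consume of «a `𝔨_ℂ`-stable subspace `S` is `⊕_λ (S ∩ W_λ)`» (DESIGN-S2 §3 (vi)–(viii)) is exactly:
* (A) **COMPONENT EXTRACTION** `mem_of_sum_mem_of_eigen` (pure linear algebra: two operators `E`, `C` preserving `S`, a finite family of joint eigenvectors with pairwise
  distinct eigenvalue PAIRS, sum in `S` ⇒ each in `S` — Lagrange ∕ induction on the family) and its K-type form **`mem_of_sum_mem_kType`** (labels `(k,l)`, ★ K-2a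
  `euler_eq_smul_of_mem`, `casimir_eq_smul_of_mem`, `eq_of_eigenvalues_eq`), with the two-component corollary **`mem_and_mem_of_add_mem_kType`** (the shape of S2-T's
  identities (4) and (8): `α·H_k D^l + β·u₀₀^{k−1}D^{l+1} ∈ S ⇒` both summands `∈ S`);
* (B) **CYCLICITY** `kType_le_of_fkl_mem`: if `S` is stable under the eight fields `R_{ab}`, `L_{ab}` and contains `F_{k,l} = u₀₀^k D^l`, then `W_{(k+l,l)} ≤ S` — by the
  NILPOTENT STRINGS `L_{01}: e₀uη ↦ e₁uη ↦ 0`, `R_{10}: ξue₀ ↦ ξue₁ ↦ 0` (generic lemma `mul_pow_mul_pow_mem_of_step`) and the binomial expansion of `(ξuη)^k`.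
So S2-C's «LIVE ARROW» step reads: `W k l ≤ S`, `X ∈ {P_{ab}, M_{ab}}` preserves `S`, S2-T gives `X(F_{k,l}) = α·v₁ + β·v₂` with `v_i ∈ W_{λ_i}` (★ K-1 memberships),
(A) ⇒ `β·v₂ ∈ S`, `β ≠ 0` ⇒ `v₂ = F_{λ₂}` or a vector whose `(A)`-component… ∈ S, (B) ⇒ `W_{λ₂} ≤ S`.  Irreducibility «`S ∩ W ∈ {0, W}`» and the direct-sum decomposition of
the whole ring are NOT needed on this road and are not typed here.

HONEST LABEL: HC_CM is proved only modulo the 7 printed citations (2 remaining named inputs: hLiu418 = stmt-HodgeConjecture-24832, h413 = stmt-HodgeConjecture-24833)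
until rung 0 closes; helper, closes no item.
References: [LeeZhu1998] S. T. Lee, C.-B. Zhu, Trans. AMS 350 (1998) p. 5032 (K-types, multiplicity one, transitions); [KashiwaraVergne1978] Invent. Math. 44 (1978) §II.5;
[Howe1989Remarks] R. Howe, Trans. AMS 313 (1989) §2.
-/

set_option autoImplicit false
set_option linter.dupNamespace false -- the mandated namespace repeats `HodgeConjecture.HodgeConjecture`

noncomputable section

open Matrix
open Summit.HodgeConjecture.HodgeConjecture.Cruxes.HLiu418.K2LiuU22CompactPictureDefs
open Summit.HodgeConjecture.HodgeConjecture.Cruxes.HLiu418.K2LiuU22KTypeMembership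
open Summit.HodgeConjecture.HodgeConjecture.Cruxes.HLiu418.K2LiuU22KTypeStability
open Summit.HodgeConjecture.HodgeConjecture.Cruxes.HLiu418.K2LiuU22KTypeEigenvalues

namespace Summit.HodgeConjecture.HodgeConjecture.Cruxes.HLiu418.K2LiuU22KTypeStructure

/-! ## §1 (A) Component extraction by two commuting families of eigenvalues -/

section Extraction

variable {V : Type*} [AddCommGroup V] [Module ℂ V]

/-- **COMPONENT EXTRACTION**: `S` a subspace stable under two linear operators `E`, `C`; `(s_i)_{i∈F}` joint eigenvectors (`E s_i = e_i s_i`, `C s_i = c_i s_i`) with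
pairwise distinct eigenvalue pairs; if `Σ_{i∈F} s_i ∈ S` then every `s_i ∈ S` (apply `E − e_j`, `C − c_j` and induct on `F`). [cite: LeeZhu1998, p. 5032] -/
theorem mem_of_sum_mem_of_eigen (S : Submodule ℂ V) (E C : V →ₗ[ℂ] V) (hE : ∀ v ∈ S, E v ∈ S) (hC : ∀ v ∈ S, C v ∈ S) {ι : Type*} (e c : ι → ℂ)
    (F : Finset ι) (hsep : ∀ i ∈ F, ∀ j ∈ F, i ≠ j → e i ≠ e j ∨ c i ≠ c j)
    (s : ι → V) (hEs : ∀ i ∈ F, E (s i) = e i • s i) (hCs : ∀ i ∈ F, C (s i) = c i • s i) (hsum : ∑ i ∈ F, s i ∈ S) :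
    ∀ i ∈ F, s i ∈ S := by
  classical
  induction F using Finset.induction_on generalizing s with
  | empty => intro i hi; exact absurd hi (Finset.notMem_empty i)
  | insert j F hj ih =>
    rw [Finset.sum_insert hj] at hsum
    have hsep' : ∀ i ∈ F, ∀ i' ∈ F, i ≠ i' → e i ≠ e i' ∨ c i ≠ c i' :=
      fun i hi i' hi' h => hsep i (Finset.mem_insert_of_mem hi) i' (Finset.mem_insert_of_mem hi') h
    -- the `E`-twisted family over `F`
    have hEfam : ∀ i ∈ F, (e i - e j) • s i ∈ S := by
      have hsum' : ∑ i ∈ F, (e i - e j) • s i ∈ S := by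
        have hx : E (s j + ∑ i ∈ F, s i) - e j • (s j + ∑ i ∈ F, s i) ∈ S := S.sub_mem (hE _ hsum) (S.smul_mem _ hsum)
        have hcalc : E (s j + ∑ i ∈ F, s i) - e j • (s j + ∑ i ∈ F, s i) = ∑ i ∈ F, (e i - e j) • s i := by
          rw [map_add, map_sum, hEs j (Finset.mem_insert_self j F), smul_add, Finset.smul_sum,
            Finset.sum_congr rfl fun i hi => hEs i (Finset.mem_insert_of_mem hi)]
          simp only [sub_smul, Finset.sum_sub_distrib]
          abel
        rwa [hcalc] at hx
      refine ih hsep' (fun i => (e i - e j) • s i) (fun i hi => ?_) (fun i hi => ?_) hsum'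
      · rw [map_smul, hEs i (Finset.mem_insert_of_mem hi), smul_comm]
      · rw [map_smul, hCs i (Finset.mem_insert_of_mem hi), smul_comm]
    -- the `C`-twisted family over `F`
    have hCfam : ∀ i ∈ F, (c i - c j) • s i ∈ S := by
      have hsum' : ∑ i ∈ F, (c i - c j) • s i ∈ S := by
        have hx : C (s j + ∑ i ∈ F, s i) - c j • (s j + ∑ i ∈ F, s i) ∈ S := S.sub_mem (hC _ hsum) (S.smul_mem _ hsum)
        have hcalc : C (s j + ∑ i ∈ F, s i) - c j • (s j + ∑ i ∈ F, s i) = ∑ i ∈ F, (c i - c j) • s i := by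
          rw [map_add, map_sum, hCs j (Finset.mem_insert_self j F), smul_add, Finset.smul_sum,
            Finset.sum_congr rfl fun i hi => hCs i (Finset.mem_insert_of_mem hi)]
          simp only [sub_smul, Finset.sum_sub_distrib]
          abel
        rwa [hcalc] at hx
      refine ih hsep' (fun i => (c i - c j) • s i) (fun i hi => ?_) (fun i hi => ?_) hsum'
      · rw [map_smul, hEs i (Finset.mem_insert_of_mem hi), smul_comm]
      · rw [map_smul, hCs i (Finset.mem_insert_of_mem hi), smul_comm]
    -- every `s i`, `i ∈ F`, is in `S`
    have hF : ∀ i ∈ F, s i ∈ S := by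
      intro i hi
      have hij : i ≠ j := fun h => hj (h ▸ hi)
      rcases hsep i (Finset.mem_insert_of_mem hi) j (Finset.mem_insert_self j F) hij with hne | hne
      · have h := S.smul_mem (e i - e j)⁻¹ (hEfam i hi)
        rwa [inv_smul_smul₀ (sub_ne_zero.2 hne)] at h
      · have h := S.smul_mem (c i - c j)⁻¹ (hCfam i hi)
        rwa [inv_smul_smul₀ (sub_ne_zero.2 hne)] at h
    -- and `s j` by difference
    have hjS : s j ∈ S := by
      have h := S.sub_mem hsum (S.sum_mem fun i hi => hF i hi)
      rwa [add_sub_cancel_right] at h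
    intro i hi
    rcases Finset.mem_insert.1 hi with rfl | hi'
    · exact hjS
    · exact hF i hi'

end Extraction

/-! ### The K-type form of (A) -/

section KTypeExtraction

/-- stability under all `R_{ab}` gives stability under the Euler operator. [folklore] -/
theorem euler_mem_of_rOp_mem (S : Submodule ℂ Carrier) (hR : ∀ a b : Fin 2, ∀ v ∈ S, rOp pd uMat a b v ∈ S) (v : Carrier) (hv : v ∈ S) :
    euler pd uMat v ∈ S := by
  rw [euler_eq_sum_rOp]
  exact S.sum_mem fun a _ => hR a a v hv

/-- stability under all `R_{ab}` gives stability under the Casimir operator. [folklore] -/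
theorem casimir_mem_of_rOp_mem (S : Submodule ℂ Carrier) (hR : ∀ a b : Fin 2, ∀ v ∈ S, rOp pd uMat a b v ∈ S) (v : Carrier) (hv : v ∈ S) :
    casimir pd uMat v ∈ S := by
  rw [casimir_apply]
  exact S.sum_mem fun a _ => S.sum_mem fun b _ => hR a b _ (hR b a v hv)

/-- **COMPONENT EXTRACTION FOR K-TYPES**: `S ≤ 𝒜` stable under `E` and `C` (e.g. under all `R_{ab}`), `(s_λ)_{λ∈F}` with `s_λ ∈ W_{(k_λ+l_λ, l_λ)}` for a finite set `F`
of DISTINCT labels `λ = (k,l)`, and `Σ_λ s_λ ∈ S` ⇒ every `s_λ ∈ S`. [cite: LeeZhu1998, p. 5032] [cite: KashiwaraVergne1978, §II.5] -/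
theorem mem_of_sum_mem_kType (S : Submodule ℂ Carrier) (hE : ∀ v ∈ S, euler pd uMat v ∈ S) (hC : ∀ v ∈ S, casimir pd uMat v ∈ S)
    (F : Finset (ℕ × ℤ)) (s : ℕ × ℤ → Carrier) (hs : ∀ kl ∈ F, s kl ∈ kType kl.1 kl.2) (hsum : ∑ kl ∈ F, s kl ∈ S) :
    ∀ kl ∈ F, s kl ∈ S := by
  refine mem_of_sum_mem_of_eigen S (euler pd uMat) (casimir pd uMat) hE hC
    (fun kl : ℕ × ℤ => (kl.1 : ℂ) + 2 * (kl.2 : ℂ)) (fun kl : ℕ × ℤ => ((kl.1 : ℂ) + kl.2) ^ 2 + (kl.2 : ℂ) ^ 2 + kl.1) F ?_ s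
    (fun kl hkl => euler_eq_smul_of_mem kl.1 kl.2 (hs kl hkl)) (fun kl hkl => casimir_eq_smul_of_mem kl.1 kl.2 (hs kl hkl)) hsum
  intro i _ j _ hij
  by_contra h
  rw [not_or, not_ne_iff, not_ne_iff] at h
  obtain ⟨h1, h2⟩ := eq_of_eigenvalues_eq h.1 h.2
  exact hij (Prod.ext h1 h2)

/-- **TWO COMPONENTS** (the shape of S2-T's identities (4), (8)): `s₁ ∈ W_{λ₁}`, `s₂ ∈ W_{λ₂}`, `λ₁ ≠ λ₂`, `s₁ + s₂ ∈ S` (`S` stable under `E`, `C`) ⇒ `s₁ ∈ S ∧ s₂ ∈ S`.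
[cite: LeeZhu1998, p. 5032] -/
theorem mem_and_mem_of_add_mem_kType (S : Submodule ℂ Carrier) (hE : ∀ v ∈ S, euler pd uMat v ∈ S) (hC : ∀ v ∈ S, casimir pd uMat v ∈ S)
    {k₁ k₂ : ℕ} {l₁ l₂ : ℤ} (hne : (k₁, l₁) ≠ (k₂, l₂)) {s₁ s₂ : Carrier} (h₁ : s₁ ∈ kType k₁ l₁) (h₂ : s₂ ∈ kType k₂ l₂) (hsum : s₁ + s₂ ∈ S) :
    s₁ ∈ S ∧ s₂ ∈ S := by
  classical
  let s : ℕ × ℤ → Carrier := fun kl => if kl = (k₁, l₁) then s₁ else s₂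
  have hs1 : s (k₁, l₁) = s₁ := if_pos rfl
  have hs2 : s (k₂, l₂) = s₂ := if_neg (Ne.symm hne)
  have hmem : ∀ kl ∈ ({(k₁, l₁), (k₂, l₂)} : Finset (ℕ × ℤ)), s kl ∈ kType kl.1 kl.2 := by
    intro kl hkl
    rcases Finset.mem_insert.1 hkl with rfl | hkl
    · rw [hs1]; exact h₁
    · rw [Finset.mem_singleton.1 hkl, hs2]; exact h₂
  have hsum' : ∑ kl ∈ ({(k₁, l₁), (k₂, l₂)} : Finset (ℕ × ℤ)), s kl ∈ S := by
    rw [Finset.sum_pair hne, hs1, hs2]; exact hsum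
  have h := mem_of_sum_mem_kType S hE hC _ s hmem hsum'
  exact ⟨hs1 ▸ h _ (Finset.mem_insert_self _ _), hs2 ▸ h _ (Finset.mem_insert_of_mem (Finset.mem_singleton_self _))⟩

end KTypeExtraction

/-! ## §2 (B) Cyclicity: nilpotent strings and the binomial expansion -/

section Strings

variable {R : Type*} [CommRing R] [Algebra ℂ R]

/-- power rule for an operator with the Leibniz rule. [folklore] -/
theorem leibniz_pow (N : R →ₗ[ℂ] R) (hmul : ∀ a b : R, N (a * b) = a * N b + b * N a) (x : R) (n : ℕ) :
    N (x ^ n) = (n : R) * x ^ (n - 1) * N x := by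
  have h1 : N 1 = 0 := by
    have h := hmul 1 1
    rw [one_mul, one_mul] at h
    -- `N 1 = N 1 + N 1`
    have : N 1 + N 1 - N 1 = N 1 - N 1 := by rw [← h]
    simpa using this
  induction n with
  | zero => rw [pow_zero, h1, Nat.cast_zero, zero_mul, zero_mul]
  | succ n ih =>
    rw [pow_succ, hmul, ih, Nat.add_sub_cancel, Nat.cast_succ]
    rcases n with _ | n
    · simp
    · rw [Nat.add_sub_cancel, pow_succ]
      ring

/-- **THE STRING LEMMA**: `N` a Leibniz operator preserving `S` with `N z = 0`, `N x = y`, `N y = 0`; if `z·x^k ∈ S` then `z·x^{k−m}·y^m ∈ S` for all `m ≤ k`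
(`N(z x^a y^b) = a·z x^{a−1} y^{b+1}`, divide by `a ≠ 0`). [cite: KashiwaraVergne1978, §II.5] -/
theorem mul_pow_mul_pow_mem_of_step (S : Submodule ℂ R) (N : R →ₗ[ℂ] R) (hN : ∀ v ∈ S, N v ∈ S) (hmul : ∀ a b : R, N (a * b) = a * N b + b * N a)
    (z x y : R) (hz : N z = 0) (hx : N x = y) (hy : N y = 0) (k : ℕ) (h : z * x ^ k ∈ S) : ∀ m ≤ k, z * x ^ (k - m) * y ^ m ∈ S := by
  intro m
  induction m with
  | zero => intro _; rwa [Nat.sub_zero, pow_zero, mul_one]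
  | succ m ih =>
    intro hm
    have hprev := ih (Nat.le_of_succ_le hm)
    have hkm : 0 < k - m := Nat.sub_pos_of_lt (Nat.lt_of_succ_le hm)
    -- `N (z x^{k−m} y^m) = (k−m) · z x^{k−m−1} y^{m+1}`
    have hstep : N (z * x ^ (k - m) * y ^ m) = ((k - m : ℕ) : R) * (z * x ^ (k - (m + 1)) * y ^ (m + 1)) := by
      rw [hmul, hmul, leibniz_pow N hmul x, leibniz_pow N hmul y, hz, hx, hy, show k - m - 1 = k - (m + 1) from rfl, pow_succ]
      ring
    have hmem : ((k - m : ℕ) : R) * (z * x ^ (k - (m + 1)) * y ^ (m + 1)) ∈ S := by rw [← hstep]; exact hN _ hprev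
    have hne : ((k - m : ℕ) : ℂ) ≠ 0 := by exact_mod_cast hkm.ne'
    have e1 : ((k - m : ℕ) : R) * (z * x ^ (k - (m + 1)) * y ^ (m + 1)) = ((k - m : ℕ) : ℂ) • (z * x ^ (k - (m + 1)) * y ^ (m + 1)) := by
      rw [Algebra.smul_def, map_natCast]
    rw [e1] at hmem
    have h2 := S.smul_mem (((k - m : ℕ) : ℂ))⁻¹ hmem
    rwa [inv_smul_smul₀ hne] at h2

/-- **BINOMIAL STEP**: if `z·x^{k−m}·y^m ∈ S` for all `m ≤ k` then `z·(c₀x + c₁y)^k ∈ S` for all scalars. [folklore] -/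
theorem mul_add_pow_mem_of_strings (S : Submodule ℂ R) (z x y : R) (k : ℕ) (h : ∀ m ≤ k, z * x ^ (k - m) * y ^ m ∈ S) (c₀ c₁ : ℂ) :
    z * (c₀ • x + c₁ • y) ^ k ∈ S := by
  rw [add_pow, Finset.mul_sum]
  refine S.sum_mem fun m hm => ?_
  have hmk : m ≤ k := Nat.lt_succ_iff.1 (Finset.mem_range.1 hm)
  have e : z * ((c₀ • x) ^ m * (c₁ • y) ^ (k - m) * (k.choose m : R)) = ((c₀ ^ m * c₁ ^ (k - m)) * (k.choose m : ℂ)) • (z * x ^ (k - (k - m)) * y ^ (k - m)) := by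
    rw [Nat.sub_sub_self hmk, smul_pow, smul_pow, Algebra.smul_def, Algebra.smul_def, Algebra.smul_def, map_mul, map_mul, map_pow, map_pow, map_natCast]
    ring
  rw [e]
  exact S.smul_mem _ (h (k - m) (Nat.sub_le k m))

end Strings

section Cyclicity

/-- `ξ·u·η = ξ₀·(e₀·u·η) + ξ₁·(e₁·u·η)` (left expansion). [folklore] -/
theorem bil_eq_sum_single_left {R : Type*} [CommRing R] [Algebra ℂ R] (u : Matrix (Fin 2) (Fin 2) R) (ξ η : Fin 2 → ℂ) :
    bil u ξ η = ξ 0 • bil u (Pi.single 0 1) η + ξ 1 • bil u (Pi.single 1 1) η := by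
  simp only [bil, Fin.sum_univ_two, Pi.single_eq_same, Pi.single_eq_of_ne (zero_ne_one : (0 : Fin 2) ≠ 1),
    Pi.single_eq_of_ne (one_ne_zero : (1 : Fin 2) ≠ 0), one_mul, zero_mul, zero_smul, add_zero, zero_add, smul_add, smul_smul]

/-- **LEFT STRINGS**: if `D^l (e₀uη)^k ∈ S` and `S` is `L_{01}`-stable then `D^l (ξuη)^k ∈ S` for every `ξ` (`L_{01}: e₀uη ↦ e₁uη ↦ 0`, `L_{01} D^l = 0`).
[cite: KashiwaraVergne1978, §II.5] -/
theorem dz_mul_bil_pow_mem_of_left (S : Submodule ℂ Carrier) (hL : ∀ v ∈ S, lOp pd uMat 0 1 v ∈ S) (k : ℕ) (l : ℤ) (η : Fin 2 → ℂ)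
    (h : dz l * bil uMat (Pi.single 0 1) η ^ k ∈ S) (ξ : Fin 2 → ℂ) : dz l * bil uMat ξ η ^ k ∈ S := by
  have hstr := mul_pow_mul_pow_mem_of_step S (lOp pd uMat 0 1) hL (fun a b => lOp_mul pd uMat 0 1 a b) (dz l) (bil uMat (Pi.single 0 1) η)
    (bil uMat (Pi.single 1 1) η) (by rw [lOp_dz, if_neg (zero_ne_one : (0 : Fin 2) ≠ 1)])
    (by rw [lOp_bil pd uMat pd_uMat, Pi.single_eq_same, one_smul]) (by rw [lOp_bil pd uMat pd_uMat, Pi.single_eq_of_ne (zero_ne_one : (0 : Fin 2) ≠ 1), zero_smul]) k h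
  rw [bil_eq_sum_single_left uMat ξ η]
  exact mul_add_pow_mem_of_strings S _ _ _ k hstr (ξ 0) (ξ 1)

/-- **RIGHT STRINGS**: if `D^l (ξue₀)^k ∈ S` and `S` is `R_{10}`-stable then `D^l (ξuη)^k ∈ S` for every `η` (`R_{10}: ξue₀ ↦ ξue₁ ↦ 0`, `R_{10} D^l = 0`).
[cite: KashiwaraVergne1978, §II.5] -/
theorem dz_mul_bil_pow_mem_of_right (S : Submodule ℂ Carrier) (hR : ∀ v ∈ S, rOp pd uMat 1 0 v ∈ S) (k : ℕ) (l : ℤ) (ξ : Fin 2 → ℂ)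
    (h : dz l * bil uMat ξ (Pi.single 0 1) ^ k ∈ S) (η : Fin 2 → ℂ) : dz l * bil uMat ξ η ^ k ∈ S := by
  have hstr := mul_pow_mul_pow_mem_of_step S (rOp pd uMat 1 0) hR (fun a b => rOp_mul pd uMat 1 0 a b) (dz l) (bil uMat ξ (Pi.single 0 1))
    (bil uMat ξ (Pi.single 1 1)) (by rw [rOp_dz, if_neg (one_ne_zero : (1 : Fin 2) ≠ 0)])
    (by rw [rOp_bil pd uMat pd_uMat, Pi.single_eq_same, one_smul]) (by rw [rOp_bil pd uMat pd_uMat, Pi.single_eq_of_ne (zero_ne_one : (0 : Fin 2) ≠ 1), zero_smul]) k h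
  rw [bil_eq_sum_single uMat ξ η]
  exact mul_add_pow_mem_of_strings S _ _ _ k hstr (η 0) (η 1)

/-- **(B) CYCLICITY FROM THE HIGHEST-WEIGHT VECTOR**: if `S` is stable under `L_{01}` and `R_{10}` and `F_{k,l} = u₀₀^k D^l ∈ S`, then `W_{(k+l,l)} ≤ S`.
[cite: LeeZhu1998, p. 5032] [cite: KashiwaraVergne1978, §II.5] -/
theorem kType_le_of_fkl_mem (S : Submodule ℂ Carrier) (hL : ∀ v ∈ S, lOp pd uMat 0 1 v ∈ S) (hR : ∀ v ∈ S, rOp pd uMat 1 0 v ∈ S) (k : ℕ) (l : ℤ)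
    (h : fkl uMat dz k l ∈ S) : kType k l ≤ S := by
  refine Submodule.span_le.2 ?_
  rintro _ ⟨ξ, η, rfl⟩
  have h0 : dz l * bil uMat (Pi.single 0 1) (Pi.single 0 1) ^ k ∈ S := by
    rw [bil_single_zero_zero uMat, mul_comm]; exact h
  exact dz_mul_bil_pow_mem_of_right S hR k l ξ (dz_mul_bil_pow_mem_of_left S hL k l (Pi.single 0 1) h0 ξ) η

/-- the converse direction: `W_{(k+l,l)} ≤ S ⇒ F_{k,l} ∈ S`. [cite: LeeZhu1998, p. 5032] -/
theorem fkl_mem_of_kType_le (S : Submodule ℂ Carrier) (k : ℕ) (l : ℤ) (h : kType k l ≤ S) : fkl uMat dz k l ∈ S :=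
  h (fkl_mem_kType k l)

/-- **the S2-C one-liner**: for `S` stable under all `L_{ab}`, `R_{ab}`: `W_{(k+l,l)} ≤ S ↔ F_{k,l} ∈ S`. [cite: LeeZhu1998, p. 5032] -/
theorem kType_le_iff_fkl_mem (S : Submodule ℂ Carrier) (hL : ∀ a b : Fin 2, ∀ v ∈ S, lOp pd uMat a b v ∈ S) (hR : ∀ a b : Fin 2, ∀ v ∈ S, rOp pd uMat a b v ∈ S)
    (k : ℕ) (l : ℤ) : kType k l ≤ S ↔ fkl uMat dz k l ∈ S :=
  ⟨fkl_mem_of_kType_le S k l, kType_le_of_fkl_mem S (hL 0 1) (hR 1 0) k l⟩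

end Cyclicity

end Summit.HodgeConjecture.HodgeConjecture.Cruxes.HLiu418.K2LiuU22KTypeStructure

end
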